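import Summits.BirchSwinnertonDyer.BirchSwinnertonDyer.Theorems.EisensteinPrimesMazurMCOnCellBKummerPrimeFamilyCertificate
import Summits.BirchSwinnertonDyer.BirchSwinnertonDyer.Theorems.EisensteinPrimesKummerPartners
import Literature.NumberTheory.EllipticCurves.MultiplicativeReductionJValuationProofs
import HarnessLib

/-!
# Kummer places from integer data: `p ∤ v_ℓ(Δ_min)` at a split multiplicative prime

Bridge (N) for the Kummer-character certificates of stub 4″ (`stub_lambdaCountWeak_offLocus`, line
`mudescent` of crux 3 `MazurMCOnCellB`). The sockets and certificates
(`…KummerCharacterCountStackedRat`, `…KummerPrimeCertificate`, `…KummerPrimeFamilyCertificate`) take a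
Kummer prime `ℓ` of `E = W/ℚ` through its PLACE `v` in the analytic form

* `W.HasSplitMultiplicativeReductionAt v` and
* `∀ x : ℚ_v, |j(E)|_v ≠ |x|_v ^ p` (the value `|j(E)|_v` is not a `p`-th power in the value group),

which is what the Tate-curve argument of `…KummerPlaceClasses` consumes. This file derives that form from
the INTEGER data a certificate is actually checked on:

* §1 `exp_natCast_ne_pow`: in `ℤᵐ⁰`, `exp n` is not a `p`-th power when `p ∤ n`.
* §2 `valued_j_ne_pow_of_not_dvd`: at a multiplicative place `v ∣ ℓ` of a globally minimal `W/ℚ`,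
  `|j|_v = exp (v_ℓ(Δ_min))` (Silverman VII.5.1(b), tree lemma
  `valuation_j_eq_exp_ordMinimalDiscriminant_of_hasMultiplicativeReductionAt` + the `ℚ`-dictionary
  `X11b.ordMinimalDiscriminant_eq_padicValInt`), so `p ∤ v_ℓ(Δ_min)` gives the second bullet;
  `X2.kummerPlace_of_not_dvd_padicValInt` packages both bullets from
  `W.HasSplitMultiplicativeReductionAtPrime ℓ ∧ ¬ p ∣ v_ℓ(Δ_min)`; the variants
  `…_of_not_dvd_padicValRat` (`¬ (p : ℤ) ∣ v_ℓ(Δ(W))`, the form used by `kummerSupport W p` of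
  `…EisensteinPrimesKummerPartners`) and `X2.kummerPlace_of_mem_kummerSupport` follow.
* §3 `X2.algebraicLambdaGE_of_kummerPrimes_int`: the family certificate
  `X2.algebraicLambdaGE_of_kummerPrimes` with the Kummer primes given as INTEGERS
  (`ℓ i ≠ p`, `ℓ i` away from the Tamagawa places `S`, split multiplicative, `p ∤ v_{ℓ i}(Δ_min)`),
  the places `v_{ℓ i}` being produced internally.

No new definitions, no named-fact hypotheses beyond those of the family certificate
(`hPT`, `h415`, `hWu`, `hpar`), no `sorry`. Honest framing: helper lemmas; stub 4″ stays open
class-wide; no summit statement is proved here.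
-/

set_option autoImplicit false
-- `Summit.BirchSwinnertonDyer.BirchSwinnertonDyer.…`: the summit and its single sub-problem share a name (D-0017 layout).
set_option linter.dupNamespace false

noncomputable section

open scoped Classical

open Function Field NumberField IsDedekindDomain WeierstrassCurve
  Literature.NumberTheory.EllipticCurves Literature.NumberTheory.GaloisRepresentations
  Literature.NumberTheory.GaloisCohomology
  Literature.NumberTheory.EllipticCurves.Rank1Residual Literature.NumberTheory.EllipticCurves.ModularForms
  Summit.BirchSwinnertonDyer.Rank1Residual
  Summit.BirchSwinnertonDyer.Rank1Residual.X1.GeneratorCountSqueeze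
  Summit.BirchSwinnertonDyer.Rank1Residual.X1.TamagawaSqueeze
  Summit.BirchSwinnertonDyer.BirchSwinnertonDyer.Theorems.EisensteinPrimesMazurMCOnCellBKummerPrimeFamilyCertificate
  Summit.BirchSwinnertonDyer.BirchSwinnertonDyer.Theorems.EisensteinPrimesKummerPartners

namespace Summit.BirchSwinnertonDyer.BirchSwinnertonDyer.Theorems.EisensteinPrimesMazurMCOnCellBKummerPlaceOfDiscriminant

/-! ## §1. `exp n` is not a `p`-th power in `ℤᵐ⁰` when `p ∤ n` -/

/-- In the value group `ℤᵐ⁰ = WithZero (Multiplicative ℤ)`, `exp n` (`n : ℕ`) is not a `p`-th power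
when `p ∤ n` (`p ≠ 0`): a `p`-th power is `0` or `exp (p·k)`. [folklore] -/
theorem exp_natCast_ne_pow {n p : ℕ} (hp0 : p ≠ 0) (hnd : ¬ p ∣ n) (y : WithZero (Multiplicative ℤ)) :
    WithZero.exp (n : ℤ) ≠ y ^ p := by
  intro h
  by_cases hy : y = 0
  · rw [hy, zero_pow hp0] at h
    exact WithZero.coe_ne_zero h
  · rw [← WithZero.exp_log hy, ← WithZero.exp_nsmul, nsmul_eq_mul] at h
    exact hnd (Int.natCast_dvd_natCast.mp (Dvd.intro _ (WithZero.exp_injective h).symm))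

/-! ## §2. The Kummer-place hypothesis from `p ∤ v_ℓ(Δ_min)` -/

section Place

variable {p : ℕ} [hp : Fact p.Prime]

/-- **`|j(E)|_v` is not a `p`-th power at a multiplicative place with `p ∤ v_ℓ(Δ_min)`.** For `W/ℚ`
globally minimal with multiplicative reduction at the place `v ∣ ℓ`: `|j(W)|_v = exp (ord_v Δ_min)`
(Silverman, AEC VII.5.1(b): `v(c₄) = 0`, `j·Δ = c₄³`) and `ord_v Δ_min = v_ℓ(Δ_min)`; so if
`p ∤ v_ℓ(Δ_min)` then `|j(W)|_v ≠ |x|_v ^ p` for every `x ∈ ℚ_v`.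
[cite: SilvermanAEC2009, Prop. VII.5.1(b)] -/
theorem valued_j_ne_pow_of_not_dvd (W : WeierstrassCurve ℚ) [W.IsElliptic] [W.IsGloballyMinimal]
    {ℓ : ℕ} [hℓ : Fact ℓ.Prime] (v : HeightOneSpectrum (𝓞 ℚ)) (hℓv : ((ℓ : ℕ) : 𝓞 ℚ) ∈ v.asIdeal)
    (hmult : W.HasMultiplicativeReductionAt v) (hnd : ¬ p ∣ padicValInt ℓ W.minimalDiscriminantInt)
    (x : v.adicCompletion ℚ) :
    Valued.v (algebraMap ℚ (v.adicCompletion ℚ) W.j) ≠ Valued.v x ^ p := by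
  have hj : Valued.v (algebraMap ℚ (v.adicCompletion ℚ) W.j) = v.valuation ℚ W.j :=
    HeightOneSpectrum.valuedAdicCompletion_eq_valuation' v W.j
  rw [hj, W.valuation_j_eq_exp_ordMinimalDiscriminant_of_hasMultiplicativeReductionAt v hmult,
    X11b.ordMinimalDiscriminant_eq_padicValInt W v
      (Rat.HeightOneSpectrum.primesEquiv_eq_of_natCast_mem v hℓ.out hℓv)]
  exact exp_natCast_ne_pow hp.out.ne_zero hnd _

/-- **Kummer place from integer data.** For `W/ℚ` globally minimal, a prime `ℓ` of split
multiplicative reduction with `p ∤ v_ℓ(Δ_min)`, and the place `v ∣ ℓ`: `W` has split multiplicative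
reduction at `v` and `|j(W)|_v` is not a `p`-th power in the value group of `ℚ_v` — exactly the
Kummer-place hypothesis of `res_oneCocycleClass_mem_kummerLocalConditionAt_of_split` and of the
certificates `X2.algebraicLambdaGE_of_kummerPrime(s)`. [cite: SilvermanAEC2009, Prop. VII.5.1(b)] -/
theorem X2.kummerPlace_of_not_dvd_padicValInt (W : WeierstrassCurve ℚ) [W.IsElliptic] [W.IsGloballyMinimal]
    {ℓ : ℕ} [Fact ℓ.Prime] (hsplit : W.HasSplitMultiplicativeReductionAtPrime ℓ)
    (hnd : ¬ p ∣ padicValInt ℓ W.minimalDiscriminantInt)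
    (v : HeightOneSpectrum (𝓞 ℚ)) (hℓv : ((ℓ : ℕ) : 𝓞 ℚ) ∈ v.asIdeal) :
    W.HasSplitMultiplicativeReductionAt v ∧
      ∀ x : v.adicCompletion ℚ, Valued.v (algebraMap ℚ (v.adicCompletion ℚ) W.j) ≠ Valued.v x ^ p :=
  have hs := X2.GreenbergVatsalStrictSelmerMultiplicative.hasSplitMultiplicativeReductionAt_of_mem W ℓ hsplit hℓv
  ⟨hs, valued_j_ne_pow_of_not_dvd W v hℓv hs.hasMultiplicativeReductionAt hnd⟩

omit hp in
/-- `v_ℓ(Δ(W)) = v_ℓ(Δ_min)` for a globally minimal `W/ℚ` (as a rational / integer valuation), so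
`¬ (p : ℤ) ∣ v_ℓ(Δ(W))` — the condition in `kummerSupport W p` — is `¬ p ∣ v_ℓ(Δ_min)`. [folklore] -/
theorem not_dvd_padicValInt_of_not_dvd_padicValRat (W : WeierstrassCurve ℚ) [W.IsGloballyMinimal]
    {ℓ : ℕ} (hnd : ¬ (p : ℤ) ∣ padicValRat ℓ W.Δ) :
    ¬ p ∣ padicValInt ℓ W.minimalDiscriminantInt := by
  rw [← cast_minimalDiscriminantInt W, padicValRat.of_int] at hnd
  exact fun h ↦ hnd (Int.natCast_dvd_natCast.mpr h)

/-- Kummer place from the `padicValRat` form of the integer data (`¬ (p : ℤ) ∣ v_ℓ(Δ(W))`, as in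
`kummerSupport W p`). [cite: SilvermanAEC2009, Prop. VII.5.1(b)] -/
theorem X2.kummerPlace_of_not_dvd_padicValRat (W : WeierstrassCurve ℚ) [W.IsElliptic] [W.IsGloballyMinimal]
    {ℓ : ℕ} [Fact ℓ.Prime] (hsplit : W.HasSplitMultiplicativeReductionAtPrime ℓ)
    (hnd : ¬ (p : ℤ) ∣ padicValRat ℓ W.Δ)
    (v : HeightOneSpectrum (𝓞 ℚ)) (hℓv : ((ℓ : ℕ) : 𝓞 ℚ) ∈ v.asIdeal) :
    W.HasSplitMultiplicativeReductionAt v ∧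
      ∀ x : v.adicCompletion ℚ, Valued.v (algebraMap ℚ (v.adicCompletion ℚ) W.j) ≠ Valued.v x ^ p :=
  X2.kummerPlace_of_not_dvd_padicValInt W hsplit (not_dvd_padicValInt_of_not_dvd_padicValRat W hnd) v hℓv

/-- **Members of the Kummer support are Kummer places** (given split multiplicative reduction there):
for `ℓ ∈ kummerSupport W p` (a prime `ℓ ≠ p` dividing the conductor with `p ∤ v_ℓ(Δ)`) at which the
multiplicative reduction is SPLIT, the place `v ∣ ℓ` satisfies the Kummer-place hypothesis of the
certificates. [cite: GreenbergVatsal2000, §1 (9)–(10)] -/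
theorem X2.kummerPlace_of_mem_kummerSupport (W : WeierstrassCurve ℚ) [W.IsElliptic] [W.IsGloballyMinimal]
    {ℓ : ℕ} [Fact ℓ.Prime] (hℓ : ℓ ∈ kummerSupport W p)
    (hsplit : W.HasSplitMultiplicativeReductionAtPrime ℓ)
    (v : HeightOneSpectrum (𝓞 ℚ)) (hℓv : ((ℓ : ℕ) : 𝓞 ℚ) ∈ v.asIdeal) :
    W.HasSplitMultiplicativeReductionAt v ∧
      ∀ x : v.adicCompletion ℚ, Valued.v (algebraMap ℚ (v.adicCompletion ℚ) W.j) ≠ Valued.v x ^ p :=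
  X2.kummerPlace_of_not_dvd_padicValRat W hsplit (prime_of_mem_kummerSupport hℓ).2.2.2 v hℓv

end Place

/-! ## §3. The family certificate on integer data -/

section Certificate

variable {p : ℕ} [hp : Fact p.Prime]

/-- **The Kummer-prime family certificate on integer data.** As `X2.algebraicLambdaGE_of_kummerPrimes`,
but with the `t` distinct Kummer primes given as integers: `ℓ i ≠ p`, `ℓ i` not under a Tamagawa
place of `S`, split multiplicative reduction at `ℓ i`, and `p ∤ v_{ℓ i}(Δ_min)`; the places
`v_{ℓ i}` and the Kummer-place hypotheses are produced by `X2.kummerPlace_of_not_dvd_padicValInt`.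
Conclusion unchanged: `AlgebraicLambdaGE W p (b - m)` whenever
`p ^ (b + 2·v_p(#E(ℚ)_tors)) ≤ p ^ (#S + 1) · p ^ t`, i.e. `λ_alg ≥ #S + t + 1 − 2·v_p(#E(ℚ)_tors) − m`,
modulo `hPT`/`h415`/`hWu`/`hpar` and the `μ_an ≤ m` certificate.
[cite: Greenberg1999, proof of Prop. 5.10; SilvermanAEC2009, Prop. VII.5.1(b)] -/
theorem X2.algebraicLambdaGE_of_kummerPrimes_int {W : WeierstrassCurve ℚ} [W.IsElliptic] [W.IsGloballyMinimal]
    (hodd : p ≠ 2) (hPT : poitouTate_selmerStructure_duality ℚ)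
    (h415 : Greenberg1999.prop415ii_noFiniteSubmodule_of_ordinary_or_multiplicative)
    (hWu : Wuthrich2014.thm16_charIdeal_dvd_multiplicative_of_reducible)
    (hpar : nonempty_modularParametrizationData)
    (hmult : W.HasMultiplicativeReductionAtPrime p) (htors : p ∣ W.torsionOrder)
    (S : Finset (HeightOneSpectrum (𝓞 ℚ))) (hSp : ∀ v ∈ S, ((p : ℕ) : 𝓞 ℚ) ∉ v.asIdeal)
    (hcv : ∀ v ∈ S,
      p ∣ (W.baseChange (v.adicCompletion ℚ)).localTamagawaNumber (v.adicCompletionIntegers ℚ))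
    {t : ℕ} (ℓ : Fin t → ℕ) [hℓ : ∀ i, Fact (ℓ i).Prime] (hℓinj : Function.Injective ℓ)
    (π : ∀ i, (ZMod (ℓ i))ˣ →* Multiplicative (ZMod p)) (hπ : ∀ i, ∃ u : (ZMod (ℓ i))ˣ, π i u ≠ 1)
    (hℓp : ∀ i, ℓ i ≠ p) (hℓS : ∀ i, ∀ v ∈ S, ((ℓ i : ℕ) : 𝓞 ℚ) ∉ v.asIdeal)
    (hKum : ∀ i, W.HasSplitMultiplicativeReductionAtPrime (ℓ i) ∧
      ¬ p ∣ padicValInt (ℓ i) W.minimalDiscriminantInt)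
    (hres : ∀ i, ∀ v : HeightOneSpectrum (𝓞 ℚ), (v ∈ S ∨ ((p : ℕ) : 𝓞 ℚ) ∈ v.asIdeal) →
      ∀ u : (ZMod (ℓ i))ˣ, (u : ZMod (ℓ i)) = (v.residueCard : ZMod (ℓ i)) → π i u = 1)
    (hbad : ∀ v : HeightOneSpectrum (𝓞 ℚ), v ∉ S → ((p : ℕ) : 𝓞 ℚ) ∉ v.asIdeal →
      (∀ i, ((ℓ i : ℕ) : 𝓞 ℚ) ∉ v.asIdeal) → ¬ W.HasGoodReductionAt v →
      (∀ i, ∀ u : (ZMod (ℓ i))ˣ, (u : ZMod (ℓ i)) = (v.residueCard : ZMod (ℓ i)) → π i u = 1) ∨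
      (W.HasSplitMultiplicativeReductionAt v ∧ ∀ x : v.adicCompletion ℚ,
        Valued.v (algebraMap ℚ (v.adicCompletion ℚ) W.j) ≠ Valued.v x ^ p))
    {m : ℕ} (hμ : X2.AnalyticMuLE W p m)
    {b : ℕ} (hb : p ^ (b + 2 * (W.torsionOrder).factorization p) ≤ p ^ (S.card + 1) * p ^ t) :
    AlgebraicLambdaGE W p (b - m) := by
  -- the places of the Kummer primes
  let vℓ : Fin t → HeightOneSpectrum (𝓞 ℚ) := fun i ↦
    (Rat.HeightOneSpectrum.primesEquiv (R := 𝓞 ℚ)).symm ⟨ℓ i, (hℓ i).out⟩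
  have hvℓ : ∀ i, ((ℓ i : ℕ) : 𝓞 ℚ) ∈ (vℓ i).asIdeal := fun i ↦
    (natCast_mem_asIdeal_iff_eq_primesEquiv_symm (vℓ i) (hℓ i).out).mpr rfl
  have hℓS' : ∀ i, vℓ i ∉ S := fun i h ↦ hℓS i (vℓ i) h (hvℓ i)
  have hℓp' : ∀ i, ((p : ℕ) : 𝓞 ℚ) ∉ (vℓ i).asIdeal := fun i h ↦ hℓp i
    ((Rat.HeightOneSpectrum.primesEquiv_eq_of_natCast_mem (vℓ i) (hℓ i).out (hvℓ i)).symm.trans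
      (Rat.HeightOneSpectrum.primesEquiv_eq_of_natCast_mem (vℓ i) hp.out h))
  exact X2.algebraicLambdaGE_of_kummerPrimes hodd hPT h415 hWu hpar hmult htors S hSp hcv ℓ hℓinj π hπ
    vℓ hvℓ hℓS' hℓp' (fun i ↦ X2.kummerPlace_of_not_dvd_padicValInt W (hKum i).1 (hKum i).2 (vℓ i) (hvℓ i))
    hres hbad hμ hb

end Certificate

end Summit.BirchSwinnertonDyer.BirchSwinnertonDyer.Theorems.EisensteinPrimesMazurMCOnCellBKummerPlaceOfDiscriminant
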